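import Summits.QuantumFields.YangMills.Theorems.BalabanUVNodesN15KingModelTranslationCovarianceReflections

/-!
# BalabanUVNodes ∕ N15 — THE KING-MODEL RUNG (PART Ϙ-g): COORDINATE PERMUTATIONS — KING's `A = 0` KERNELS ON THE CUBIC TORUS ARE INVARIANT UNDER RELABELLING THE
# AXES; WITH PARTS Ϙ-d∕Ϙ-f THE CONTINUUM TWO-POINT KERNEL OF A `G`-LINE DIAGRAM IS INVARIANT UNDER THE FULL HYPEROCTAHEDRAL GROUP OF THE LATTICE
# (Track A, DAG node N15 = NE2; FAN-OUT v1.1 §N15 s3 «KING-MODEL RUNG … NE2's analogue DECIDED in the model»)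

HONEST FRAMING.  Count-neutral (cell `pub-ymgap`, seat `pub-ymgap-dag-n15-e` g31; `--supports stmt-QuantumFields-27366 --as helper` = K3⁸
`SpineGivenEndpointR13SepCoPHV`).  TEMPLATE LITERATURE: C. King, *The U(1) Higgs model. I. The continuum limit*, Commun. Math. Phys. **102** (1986) 649–677
[King1986] — KING's OWN `A = 0` MODEL on CUBIC tori (all periods equal: the rung's `kingVol L jv = (2L^m, …, 2L^m)`, generic letters on `Π_μ ℤ∕n`).  NOT Bałaban's
`G(U)`; NOT a node discharge (N15 is booked through n15-a's knit, untouched here); nothing continuum ∕ ℝ⁴ ∕ OS ∕ mass-gap ∕ Clay.  0 `sorry`; standard axioms; ONE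
plumbing `def` (`torPerm`, the axis relabelling as an `Equiv`).  Sequel of parts Ϙ-a…Ϙ-f (`…TranslationCovariance{,Rung,Graphs,Continuum,Reflections}`: the
equiv-generic `inv_equiv`, `mul_equiv₃`, `graphValLS_equiv`; `kingPairLim_transl`).

THE PRINT.  (4.4) p. 670: `Δ^η(p) = 4η⁻²Σ_μ sin²(½ηp_μ) + m²(L^kε)²` and the block mean (2.10) are symmetric in the axes; hence so is every `A = 0` kernel King builds
from them, and the two-point functions of the model carry the full symmetry group of the cubic lattice — translations (parts Ϙ-a…Ϙ-e), reflections (part Ϙ-f) and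
the axis permutations typed here; [King1986II] then restores the rotations in the continuum limit.

WHAT THIS FILE PROVES (kernel).  §0 `torPerm n π : (Π_μ ℤ∕n) ≃ (Π_μ ℤ∕n)`, `x ↦ x∘π` (simp letters, additivity, `e_μ∘π = e_{π⁻¹μ}`).  §1 (generic, cubic tori
`Π_μ ℤ∕n` with `N`-blocks): `lapF_perm`, `lapF_inv_perm`, ★ `blockOf_perm`, `blockProj_perm`, `Qmat_perm`, `fineOp_perm`, ★ `fineOp_inv_perm`, ★ `constrainedProp_perm`
(`G^η_k(x∘π, y∘π) = G^η_k(x, y)`), ★ `topPiece_perm`, ★★ `minimiserMat_perm`∕`minimiser_single_perm` (`ℋ_k(x∘π, b∘π) = ℋ_k(x, b)`), ★★ `effLaplacian_perm`,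
★★ `effLaplacian_inv_perm`.  §2 (rung objects): `kingGLine_perm_none`, `kingH_perm`, `kingExtLo_perm_none`, ★ `blockCov_perm`∕`blockCovStep_perm`.  §3 (diagrams):
★ `king_graph_legsLo_perm`, ★★ `kingPairSeq_perm`, ★★★ **`kingPairLim_perm`** (`E^{(∞)}(G; b∘π, b′∘π) = E^{(∞)}(G; b, b′)`) and ★★★ **`kingPairLim_perm_sep`**
(`E^{(∞)}(G; b, b + v∘π) = E^{(∞)}(G; b, b + v)`: THE CONTINUUM TWO-POINT KERNEL IS A SYMMETRIC FUNCTION OF THE SEPARATION'S COORDINATES — with part Ϙ-f's evenness,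
invariant under the hyperoctahedral group).

HONEST SCOPE.  Cubic tori only (axis permutations need equal periods); `G`-lines and `ℋ`-legs (kinds `none`) in §2–§3 (a derivative kind `κ` relabels to `π κ`, not
typed); identities only; N15 untouched; counts unmoved.
Locators: [King1986] (2.10)–(2.15) pp.652–653, (2.17) p.653, (2.21) p.654 (the torus), Prop. 3.6 (3.56) p.662, Prop. 3.8 (3.71) p.664, (4.1)–(4.5) p.670, (4.44) p.675.
-/

noncomputable section

open scoped BigOperators
open Finset Matrix Filter

namespace Summit.QuantumFields.YangMills.BalabanUVNodes.N15KingModelRung.Perm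

open Literature.MathematicalPhysics.QuantumFieldTheory.Balaban1983to89.B5Prop11Plancherel (Tor fine unitVec)
open Literature.MathematicalPhysics.QuantumFieldTheory.King1986.Torus
open Summit.QuantumFields.YangMills.BalabanUVNodes.N15KingModelRung.Graph

variable {d : ℕ}

/-! ## §0 The axis relabelling `x ↦ x∘π` of the cubic torus `Π_μ ℤ∕n` -/

section TorPerm

variable (n : ℕ) (π : Equiv.Perm (Fin (d + 1)))

/-- **THE AXIS RELABELLING** `x ↦ x∘π` of the cubic torus `Π_{μ} ℤ∕n` (all periods equal), as an `Equiv`. [cite: King1986, (2.21) p.654, (4.4) p.670] -/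
def torPerm : Tor (fun _ : Fin (d + 1) => n) ≃ Tor (fun _ : Fin (d + 1) => n) where
  toFun x := fun ν => x (π ν)
  invFun y := fun μ => y (π.symm μ)
  left_inv x := by funext μ; exact congrArg x (π.apply_symm_apply μ)
  right_inv y := by funext μ; exact congrArg y (π.symm_apply_apply μ)

/-- `(x∘π)_ν = x_{πν}`. [folklore] -/
@[simp] theorem torPerm_apply (x : Tor (fun _ : Fin (d + 1) => n)) (ν : Fin (d + 1)) : torPerm n π x ν = x (π ν) := rfl

/-- The relabelling is additive. [folklore] -/
theorem torPerm_add (x y : Tor (fun _ : Fin (d + 1) => n)) : torPerm n π (x + y) = torPerm n π x + torPerm n π y := rfl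

/-- … and respects subtraction. [folklore] -/
theorem torPerm_sub (x y : Tor (fun _ : Fin (d + 1) => n)) : torPerm n π (x - y) = torPerm n π x - torPerm n π y := rfl

/-- `e_μ∘π = e_{π⁻¹μ}`. [folklore] -/
theorem torPerm_unitVec (μ : Fin (d + 1)) : torPerm n π (unitVec (fun _ : Fin (d + 1) => n) μ) = unitVec (fun _ : Fin (d + 1) => n) (π.symm μ) := by
  funext ν
  simp only [torPerm_apply, unitVec, Pi.single_apply, Equiv.apply_eq_iff_eq_symm_apply]

/-- `e_{πμ}∘π = e_μ`. [folklore] -/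
theorem torPerm_unitVec_apply (μ : Fin (d + 1)) : torPerm n π (unitVec (fun _ : Fin (d + 1) => n) (π μ)) = unitVec (fun _ : Fin (d + 1) => n) μ := by
  rw [torPerm_unitVec, Equiv.symm_apply_apply]

end TorPerm

/-! ## §1 King's operators on the cubic torus under the axis relabelling -/

section Operators

variable (n : ℕ) [NeZero n] (π : Equiv.Perm (Fin (d + 1)))

omit [NeZero n] in
/-- `(c(−Δ) + m²)(x∘π, y∘π) = (c(−Δ) + m²)(x, y)` (the stencil is symmetric in the axes: re-index `Σ_μ` by `π`). [cite: King1986, (4.4) p.670] -/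
theorem lapF_perm (c m2 : ℝ) (x y : Tor (fun _ : Fin (d + 1) => n)) :
    lapF (fun _ : Fin (d + 1) => n) c m2 (torPerm n π x) (torPerm n π y) = lapF (fun _ : Fin (d + 1) => n) c m2 x y := by
  unfold lapF
  have h1 : (torPerm n π y = torPerm n π x) ↔ (y = x) := (torPerm n π).injective.eq_iff
  have h2 : ∀ μ, (torPerm n π y = torPerm n π x + unitVec (fun _ : Fin (d + 1) => n) μ) ↔ (y = x + unitVec (fun _ : Fin (d + 1) => n) (π μ)) := by
    intro μ
    rw [← torPerm_unitVec_apply n π μ, ← torPerm_add, (torPerm n π).injective.eq_iff]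
  have h3 : ∀ μ, (torPerm n π y = torPerm n π x - unitVec (fun _ : Fin (d + 1) => n) μ) ↔ (y = x - unitVec (fun _ : Fin (d + 1) => n) (π μ)) := by
    intro μ
    rw [← torPerm_unitVec_apply n π μ, ← torPerm_sub, (torPerm n π).injective.eq_iff]
  simp only [h1, h2, h3]
  rw [Equiv.sum_comp π (fun μ => (if y = x + unitVec (fun _ : Fin (d + 1) => n) μ then (1 : ℝ) else 0)
    + (if y = x - unitVec (fun _ : Fin (d + 1) => n) μ then (1 : ℝ) else 0))]

/-- `C^η(x∘π, y∘π) = C^η(x, y)`. [cite: King1986, (2.17) p.653, (4.4) p.670] -/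
theorem lapF_inv_perm (c m2 : ℝ) (x y : Tor (fun _ : Fin (d + 1) => n)) :
    (lapF (fun _ : Fin (d + 1) => n) c m2)⁻¹ (torPerm n π x) (torPerm n π y) = (lapF (fun _ : Fin (d + 1) => n) c m2)⁻¹ x y :=
  inv_equiv (torPerm n π) (fun x' y' => lapF_perm n π c m2 x' y') x y

variable (N : ℕ) [NeZero N]

/-- ★ **BLOCKS RELABEL WITH THE AXES**: `B(x∘π) = B(x)∘π` (coordinatewise floor). [cite: King1986, (2.10) p.653] -/
theorem blockOf_perm (x : Tor (fine N (fun _ : Fin (d + 1) => n))) :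
    blockOf N (fun _ : Fin (d + 1) => n) (torPerm (N * n) π x) = torPerm n π (blockOf N (fun _ : Fin (d + 1) => n) x) := by
  funext μ
  apply ZMod.val_injective
  rw [val_blockOf]
  show ((torPerm (N * n) π x) μ).val / N = (blockOf N (fun _ : Fin (d + 1) => n) x (π μ)).val
  rw [val_blockOf, torPerm_apply]

/-- `Q*Q(x∘π, y∘π) = Q*Q(x, y)`. [cite: King1986, (2.10)–(2.13) p.653] -/
theorem blockProj_perm (x y : Tor (fine N (fun _ : Fin (d + 1) => n))) :
    blockProj N (fun _ : Fin (d + 1) => n) (torPerm (N * n) π x) (torPerm (N * n) π y) = blockProj N (fun _ : Fin (d + 1) => n) x y := by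
  simp only [blockProj, blockOf_perm, (torPerm n π).injective.eq_iff]

/-- `Q(b∘π, x∘π) = Q(b, x)`. [cite: King1986, (2.10) p.653] -/
theorem Qmat_perm (b : Tor (fun _ : Fin (d + 1) => n)) (x : Tor (fine N (fun _ : Fin (d + 1) => n))) :
    Qmat N (fun _ : Fin (d + 1) => n) (torPerm n π b) (torPerm (N * n) π x) = Qmat N (fun _ : Fin (d + 1) => n) b x := by
  simp only [Qmat, blockOf_perm, (torPerm n π).injective.eq_iff]

/-- `A₀(x∘π, y∘π) = A₀(x, y)`. [cite: King1986, (2.13) p.653, (4.4)–(4.5) p.670] -/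
theorem fineOp_perm (a c m2 : ℝ) (x y : Tor (fine N (fun _ : Fin (d + 1) => n))) :
    fineOp N (fun _ : Fin (d + 1) => n) a c m2 (torPerm (N * n) π x) (torPerm (N * n) π y) = fineOp N (fun _ : Fin (d + 1) => n) a c m2 x y := by
  rw [fineOp, Matrix.add_apply, Matrix.add_apply, Matrix.smul_apply, Matrix.smul_apply, blockProj_perm]
  congr 1
  exact lapF_perm (N * n) π c m2 x y

/-- ★ `A₀⁻¹(x∘π, y∘π) = A₀⁻¹(x, y)`. [cite: King1986, (2.13) p.653, (4.5) p.670] -/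
theorem fineOp_inv_perm (a c m2 : ℝ) (x y : Tor (fine N (fun _ : Fin (d + 1) => n))) :
    (fineOp N (fun _ : Fin (d + 1) => n) a c m2)⁻¹ (torPerm (N * n) π x) (torPerm (N * n) π y)
      = (fineOp N (fun _ : Fin (d + 1) => n) a c m2)⁻¹ x y :=
  inv_equiv (torPerm (N * n) π) (fun x' y' => fineOp_perm n π N a c m2 x' y') x y

/-- ★ **`G^η_k(x∘π, y∘π) = G^η_k(x, y)`.** [cite: King1986, (2.13) p.653, (4.44) p.675] -/
theorem constrainedProp_perm (a c m2 : ℝ) (x y : Tor (fine N (fun _ : Fin (d + 1) => n))) :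
    constrainedProp N (fun _ : Fin (d + 1) => n) a c m2 (torPerm (N * n) π x) (torPerm (N * n) π y)
      = constrainedProp N (fun _ : Fin (d + 1) => n) a c m2 x y := by
  rw [constrainedProp, Matrix.smul_apply, Matrix.smul_apply, fineOp_inv_perm]

/-- ★ **`G^η_{(K)}(x∘π, y∘π) = G^η_{(K)}(x, y)`.** [cite: King1986, (2.17) p.653, (4.44) p.675] -/
theorem topPiece_perm (a c m2 : ℝ) (x y : Tor (fine N (fun _ : Fin (d + 1) => n))) :
    topPiece N (fun _ : Fin (d + 1) => n) a c m2 (torPerm (N * n) π x) (torPerm (N * n) π y) = topPiece N (fun _ : Fin (d + 1) => n) a c m2 x y := by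
  rw [topPiece, Matrix.smul_apply, Matrix.smul_apply, Matrix.sub_apply, Matrix.sub_apply, fineOp_inv_perm]
  congr 2
  exact lapF_inv_perm (N * n) π c m2 x y

/-- ★★ **`ℋ_k(x∘π, b∘π) = ℋ_k(x, b)`.** [cite: King1986, (2.15) p.653] -/
theorem minimiserMat_perm (a c m2 : ℝ) (x : Tor (fine N (fun _ : Fin (d + 1) => n))) (b : Tor (fun _ : Fin (d + 1) => n)) :
    minimiserMat N (fun _ : Fin (d + 1) => n) a c m2 (torPerm (N * n) π x) (torPerm n π b) = minimiserMat N (fun _ : Fin (d + 1) => n) a c m2 x b := by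
  rw [minimiserMat, Matrix.smul_apply, Matrix.smul_apply]
  congr 1
  exact mul_equiv₃ _ _ (torPerm (N * n) π) (torPerm (N * n) π) (torPerm n π) (fun x' y' => fineOp_inv_perm n π N a c m2 x' y')
    (fun y' b' => by rw [Matrix.transpose_apply, Matrix.transpose_apply]; exact Qmat_perm n π N b' y') x b

/-- `ℋ_k(x∘π, b∘π) = ℋ_k(x, b)` in the `minimiser (δ_b)` spelling. [cite: King1986, (2.15) p.653] -/
theorem minimiser_single_perm (a c m2 : ℝ) (x : Tor (fine N (fun _ : Fin (d + 1) => n))) (b : Tor (fun _ : Fin (d + 1) => n)) :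
    minimiser N (fun _ : Fin (d + 1) => n) a c m2 (Pi.single (torPerm n π b) 1) (torPerm (N * n) π x)
      = minimiser N (fun _ : Fin (d + 1) => n) a c m2 (Pi.single b 1) x := by
  rw [← minimiserMat_apply, ← minimiserMat_apply, minimiserMat_perm]

/-- ★★ **`Δ^{(k)}(b∘π, b′∘π) = Δ^{(k)}(b, b′)`.** [cite: King1986, (2.14) p.653, (4.5) p.670] -/
theorem effLaplacian_perm (a c m2 : ℝ) (b b' : Tor (fun _ : Fin (d + 1) => n)) :
    effLaplacian N (fun _ : Fin (d + 1) => n) a c m2 (torPerm n π b) (torPerm n π b') = effLaplacian N (fun _ : Fin (d + 1) => n) a c m2 b b' := by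
  rw [effLaplacian, Matrix.sub_apply, Matrix.sub_apply, Matrix.smul_apply, Matrix.smul_apply, Matrix.smul_apply, Matrix.smul_apply,
    Matrix.one_apply, Matrix.one_apply]
  simp only [(torPerm n π).injective.eq_iff]
  congr 2
  refine mul_equiv₃ _ _ (torPerm n π) (torPerm (N * n) π) (torPerm n π) (fun b₁ y₁ => ?_)
    (fun y' b'' => by rw [Matrix.transpose_apply, Matrix.transpose_apply]; exact Qmat_perm n π N b'' y') b b'
  exact mul_equiv₃ _ _ (torPerm n π) (torPerm (N * n) π) (torPerm (N * n) π) (fun b₃ x₃ => Qmat_perm n π N b₃ x₃)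
    (fun x' y' => fineOp_inv_perm n π N a c m2 x' y') b₁ y₁

/-- ★★ **`(Δ^{(k)})⁻¹(b∘π, b′∘π) = (Δ^{(k)})⁻¹(b, b′)`.** [cite: King1986, (2.14) p.653, (4.5) p.670, (4.41) p.675] -/
theorem effLaplacian_inv_perm (a c m2 : ℝ) (b b' : Tor (fun _ : Fin (d + 1) => n)) :
    (effLaplacian N (fun _ : Fin (d + 1) => n) a c m2)⁻¹ (torPerm n π b) (torPerm n π b') = (effLaplacian N (fun _ : Fin (d + 1) => n) a c m2)⁻¹ b b' :=
  inv_equiv (torPerm n π) (fun b₁ b₂ => effLaplacian_perm n π N a c m2 b₁ b₂) b b'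

end Operators

end Summit.QuantumFields.YangMills.BalabanUVNodes.N15KingModelRung.Perm

namespace Summit.QuantumFields.YangMills.BalabanUVNodes.N15KingModelRung.Curved

open Literature.MathematicalPhysics.QuantumFieldTheory.Balaban1983to89.B5Prop11Plancherel (Tor fine)
open Literature.MathematicalPhysics.QuantumFieldTheory.King1986 (aK)
open Literature.MathematicalPhysics.QuantumFieldTheory.King1986.Torus
open Summit.QuantumFields.YangMills.BalabanUVNodes.N15KingModelRung
open Summit.QuantumFields.YangMills.BalabanUVNodes.N15KingModelRung.Graph
open Summit.QuantumFields.YangMills.BalabanUVNodes.N15KingModelRung.Perm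

variable {d : ℕ} (L : ℕ) [NeZero L] (π : Equiv.Perm (Fin (d + 1)))

/-! ## §2 The rung's objects (the rung's tori `kingVol L jv = (2L^m, …, 2L^m)` are cubic) -/

section Rung

/-- `G^η_K(x∘π, y∘π) = G^η_K(x, y)` for the rung's `G`-line kernel. [cite: King1986, (2.13) p.653, p.663] -/
theorem kingGLine_perm_none (a msq : ℝ) (jv : KingVolIndex d) (x y : haveI := kingVol_neZero L jv; Tor (fine (L ^ jv.K) (kingVol L jv))) :
    haveI := kingVol_neZero L jv
    kingGLine L (kingVol L jv) a msq jv.K none (torPerm (L ^ jv.K * (2 * L ^ jv.m)) π x) (torPerm (L ^ jv.K * (2 * L ^ jv.m)) π y)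
      = kingGLine L (kingVol L jv) a msq jv.K none x y := by
  haveI := kingVol_neZero L jv
  haveI : NeZero (2 * L ^ jv.m) := ⟨NeZero.ne (kingVol L jv 0)⟩
  exact constrainedProp_perm (2 * L ^ jv.m) π (L ^ jv.K) _ _ _ x y

/-- `ℋ_K(x∘π, b∘π) = ℋ_K(x, b)` for the rung's `kingH`. [cite: King1986, (2.15) p.653, Prop. 3.8 (3.71) p.664] -/
theorem kingH_perm (a m2 : ℝ) (jv : KingVolIndex d) (Nf : ℕ) [NeZero Nf] (k : ℕ) (b : Tor (kingVol L jv))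
    (x : haveI := kingVol_neZero L jv; Tor (fine Nf (kingVol L jv))) :
    haveI := kingVol_neZero L jv
    kingH L Nf (kingVol L jv) a m2 k (torPerm (2 * L ^ jv.m) π b) (torPerm (Nf * (2 * L ^ jv.m)) π x) = kingH L Nf (kingVol L jv) a m2 k b x := by
  haveI := kingVol_neZero L jv
  haveI : NeZero (2 * L ^ jv.m) := ⟨NeZero.ne (kingVol L jv 0)⟩
  exact minimiser_single_perm (2 * L ^ jv.m) π Nf _ _ _ x b

/-- The coarse `ℋ`-leg is covariant under the relabelling. [cite: King1986, Prop. 3.8 (3.71) p.664] -/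
theorem kingExtLo_perm_none (a msq : ℝ) (jv : KingVolIndex d) (b : Tor (kingVol L jv))
    (x : haveI := kingVol_neZero L jv; Tor (fine (L ^ jv.K) (kingVol L jv))) :
    haveI := kingVol_neZero L jv
    kingExtLo L a msq jv (torPerm (2 * L ^ jv.m) π b) none (torPerm (L ^ jv.K * (2 * L ^ jv.m)) π x) = kingExtLo L a msq jv b none x := by
  haveI := kingVol_neZero L jv
  exact kingH_perm L π a msq jv (L ^ jv.K) jv.K b x

/-- ★ **`(Δ^{(K)})⁻¹(b∘π, b′∘π) = (Δ^{(K)})⁻¹(b, b′)`** for the rung's `blockCov`. [cite: King1986, (4.5) p.670, (4.41) p.675] -/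
theorem blockCov_perm (a m2 : ℝ) (jv : KingVolIndex d) (Nf : ℕ) [NeZero Nf] (K : ℕ) (b b' : Tor (kingVol L jv)) :
    haveI := kingVol_neZero L jv
    blockCov L Nf (kingVol L jv) a m2 K (torPerm (2 * L ^ jv.m) π b) (torPerm (2 * L ^ jv.m) π b') = blockCov L Nf (kingVol L jv) a m2 K b b' := by
  haveI := kingVol_neZero L jv
  haveI : NeZero (2 * L ^ jv.m) := ⟨NeZero.ne (kingVol L jv 0)⟩
  exact effLaplacian_inv_perm (2 * L ^ jv.m) π Nf _ _ _ b b'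

/-- ★ **… and its η-difference** (NE2's unit kernel of the model). [cite: King1986, (4.39)–(4.41) pp.674–675] -/
theorem blockCovStep_perm (a m2 : ℝ) (jv : KingVolIndex d) (b b' : Tor (kingVol L jv)) :
    blockCovStep L a m2 jv (torPerm (2 * L ^ jv.m) π b) (torPerm (2 * L ^ jv.m) π b') = blockCovStep L a m2 jv b b' := by
  haveI := kingVol_neZero L jv
  haveI : NeZero (L ^ 1 * L ^ jv.K) := ⟨mul_ne_zero (pow_ne_zero _ (NeZero.ne L)) (pow_ne_zero _ (NeZero.ne L))⟩
  unfold blockCovStep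
  rw [blockCov_perm, blockCov_perm]

end Rung

/-! ## §3 `G`-line diagrams with `ℋ`-legs; the continuum two-point kernel under the hyperoctahedral group -/

section Graphs

variable (a msq : ℝ) {nn m : ℕ} (src tgt : Fin m → Fin (nn + 1))

/-- ★ **RELABELLING THE AXES OF EVERY LEG SITE LEAVES A `G`-LINE DIAGRAM UNCHANGED** (all lines `G^η_K`, all legs `ℋ_K`). [cite: King1986, Prop. 3.6 (3.56) p.662, Prop. 3.8 (3.71) p.664, (4.4) p.670] -/
theorem king_graph_legsLo_perm (jv : KingVolIndex d) (w : ℝ) {Υ : Type*} [Fintype Υ] (vtx : Υ → Fin (nn + 1)) (b : Υ → Tor (kingVol L jv)) :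
    haveI := kingVol_neZero L jv
    graphValLS w src tgt (fun _ => kingGLine L (kingVol L jv) a msq jv.K none) vtx
        (fun υ => kingExtLo L a msq jv (torPerm (2 * L ^ jv.m) π (b υ)) none)
      = graphValLS w src tgt (fun _ => kingGLine L (kingVol L jv) a msq jv.K none) vtx (fun υ => kingExtLo L a msq jv (b υ) none) := by
  haveI := kingVol_neZero L jv
  exact graphValLS_equiv (torPerm (L ^ jv.K * (2 * L ^ jv.m)) π) _ _ _ _ _ _ _
    (fun _ x y => kingGLine_perm_none L π a msq jv x y) (fun υ x => kingExtLo_perm_none L π a msq jv (b υ) x)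

/-- ★★ **THE TWO-POINT KERNEL ALONG `K` IS INVARIANT UNDER RELABELLING THE AXES**: `E^{(K+1)}(G; y_{b∘π}, y_{b′∘π}) = E^{(K+1)}(G; y_b, y_{b′})`.
[cite: King1986, Prop. 3.6 (3.56) p.662, (4.1)–(4.5) p.670] -/
theorem kingPairSeq_perm (eM : ℕ) (v₁ : Fin (nn + 1)) (b b' : Tor (kingVol L (jvSucc (d := d) eM 0))) (K : ℕ) :
    kingPairSeq L a msq eM nn m src tgt (fun _ => none) v₁ none none (torPerm (2 * L ^ eM) π b) (torPerm (2 * L ^ eM) π b') K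
      = kingPairSeq L a msq eM nn m src tgt (fun _ => none) v₁ none none b b' K := by
  unfold kingPairSeq
  have hlegs : (fun υ => kingExtLo L a msq (jvSucc (d := d) eM K)
        ((![torPerm (2 * L ^ eM) π b, torPerm (2 * L ^ eM) π b'] : Fin 2 → Tor (kingVol L (jvSucc (d := d) eM 0))) υ) (![none, none] υ))
      = fun υ => kingExtLo L a msq (jvSucc (d := d) eM K) (torPerm (2 * L ^ (jvSucc (d := d) eM K).m) π (![b, b'] υ)) none := by
    funext υ; fin_cases υ <;> rfl
  have hlegs' : (fun υ => kingExtLo L a msq (jvSucc (d := d) eM K) (![b, b'] υ) (![none, none] υ))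
      = fun υ => kingExtLo L a msq (jvSucc (d := d) eM K) (![b, b'] υ) none := by
    funext υ; fin_cases υ <;> rfl
  rw [hlegs, hlegs']
  exact king_graph_legsLo_perm L π a msq src tgt (jvSucc (d := d) eM K) _ ![(0 : Fin (nn + 1)), v₁] ![b, b']

/-- ★★★ **THE CONTINUUM TWO-POINT KERNEL IS INVARIANT UNDER RELABELLING THE AXES**: `E^{(∞)}(G; b∘π, b′∘π) = E^{(∞)}(G; b, b′)` (`G`-lines, `ℋ`-legs; no
convergence hypothesis). [cite: King1986, Thm 2.1 (i) (2.22) p.654, (4.1)–(4.5) p.670] -/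
theorem kingPairLim_perm (eM : ℕ) (v₁ : Fin (nn + 1)) (b b' : Tor (kingVol L (jvSucc (d := d) eM 0))) :
    kingPairLim L a msq eM nn m src tgt (fun _ => none) v₁ none none (torPerm (2 * L ^ eM) π b) (torPerm (2 * L ^ eM) π b')
      = kingPairLim L a msq eM nn m src tgt (fun _ => none) v₁ none none b b' := by
  unfold kingPairLim
  rw [show kingPairSeq L a msq eM nn m src tgt (fun _ => none) v₁ none none (torPerm (2 * L ^ eM) π b) (torPerm (2 * L ^ eM) π b')
      = kingPairSeq L a msq eM nn m src tgt (fun _ => none) v₁ none none b b' from funext fun K => kingPairSeq_perm L π a msq src tgt eM v₁ b b' K]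

/-- ★★★ **THE CONTINUUM TWO-POINT KERNEL IS A SYMMETRIC FUNCTION OF THE SEPARATION's COORDINATES**: for the relabelled separation `w = v∘π`,
`E^{(∞)}(G; b, b + w) = E^{(∞)}(G; b, b + v)` — axis relabelling (this §) composed with translation invariance (part Ϙ-d); with part Ϙ-f's evenness the kernel is
invariant under the full hyperoctahedral group acting on the separation. [cite: King1986, Thm 2.1 (i) (2.22) p.654, (4.1)–(4.5) p.670] -/
theorem kingPairLim_perm_sep (eM : ℕ) (v₁ : Fin (nn + 1)) (b v w : Tor (kingVol L (jvSucc (d := d) eM 0))) (hw : ∀ ν, w ν = v (π ν)) :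
    kingPairLim L a msq eM nn m src tgt (fun _ => none) v₁ none none b (b + w)
      = kingPairLim L a msq eM nn m src tgt (fun _ => none) v₁ none none b (b + v) := by
  -- the relabelled points, read on the rung's torus type
  obtain ⟨pb, hpb⟩ : ∃ pb : Tor (kingVol L (jvSucc (d := d) eM 0)), pb = torPerm (2 * L ^ eM) π b := ⟨_, rfl⟩
  have hwv : w = torPerm (2 * L ^ eM) π v := funext hw
  have hsum : (torPerm (2 * L ^ eM) π (b + v) : Tor (kingVol L (jvSucc (d := d) eM 0))) = pb + w := by
    rw [hpb, hwv]; rfl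
  have h1 := kingPairLim_perm L π a msq src tgt eM v₁ b (b + v)
  rw [hsum, ← hpb] at h1
  have h2 := kingPairLim_transl L a msq eM src tgt (fun _ => none) v₁ none none pb (pb + w) (b - pb)
  rw [add_sub_cancel, show pb + w + (b - pb) = b + w by abel] at h2
  rw [h2, h1]

end Graphs

end Summit.QuantumFields.YangMills.BalabanUVNodes.N15KingModelRung.Curved

end
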